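import Summits.QuantumAdvantage.QuantumAdvantage.Theses.ArithStatLadder
import Literature.Computability.Complexity.QuadraticCongruencesNP
import Literature.Computability.Complexity.ZIntBricks
import Literature.Computability.Complexity.PPolyComplement
import Literature.Computability.Complexity.CircuitClassesUniformProofs

/-!
# The apex of line `Sketch` is a separation statement: `SQUAREFUL ∈ NP`, so
`SQUAREFREES ∉ P/poly ⇒ NP ⊄ P/poly`

Helper file for the crux `ArithStatLadder.IqThreeNotPPoly` (stmt-QuantumAdvantage-2422), line
`Sketch` (SQUAREFREE-FILTER DOMINATION), continuation lead c2. The line is complete modulo its apex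
`stub_sqfreeNotPPoly : bin {m | Squarefree m} ∉ P/poly` (the crux follows from it by the accepted
tree theorem `iqThreeNotPPoly_of_sqfreeNotPPoly` of `Theorems/ArithStatLadderIqThreeNotPPolyNagell.lean`,
not re-imported here). This file kernel-checks the STATUS of that apex, which so far was prose: the
complement of `SQF = bin {m | Squarefree m}` — the non-numerals together with the numerals of
non-squarefree `m` — has one-numeral certificates (`m = 0`, or `x ≥ 2` with `x² ∣ m`,
`|⌜x⌝| ≤ |⌜m⌝|`) checked by a brick-assembled polynomial-time verifier
(`exists_squareful_verifier`), so it lies in `NP` (`squarefree_compl_mem_NP`; equivalently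
`SQF ∈ coNP`, `squarefree_mem_coNP`). Consequently the apex implies `NP ⊄ P/poly`
(`NP_not_subset_PPoly_of_squarefree_not_mem_PPoly`, by closure of `P/poly` under complement) and
`P ≠ NP` (`P_ne_NP_of_squarefree_not_mem_PPoly`): promoting the apex to an item files a statement of
Karp–Lipton strength — the barrier `Literature.Barriers.QuantumAdvantage.SeparationPrerequisites`
applies to it exactly as to the crux. No definition is introduced (the verifier is a closed brick
term, packaged existentially).

References: S. Arora, B. Barak, *Computational Complexity*, CUP 2009, Def. 2.1 (NP by
certificates), Def. 2.19 (coNP), §6.1 (`P ⊆ P/poly`, complement); L. M. Adleman, K. S. McCurley,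
*Open problems in number theoretic complexity, II*, ANTS-I, LNCS 877 (1994), problem O8
(SQUAREFREES ∈ `NP ∩ coNP`, not known to be in `P`).
-/

noncomputable section

set_option linter.dupNamespace false

namespace Summit.QuantumAdvantage.QuantumAdvantage.Theorems.IqThreeNotPPoly

open _root_.Computability Polynomial
open Literature.Computability.Complexity Literature.Computability.Complexity.Brick

/-! ### Arithmetic of the certificates -/

/-- A non-squarefree `m` is `0` or has a square factor `x²`, `2 ≤ x ≤ m`. -/
theorem exists_sq_dvd_of_not_squarefree {m : ℕ} (hm : ¬ Squarefree m) :
    m = 0 ∨ ∃ x : ℕ, 2 ≤ x ∧ x * x ∣ m ∧ x ≤ m := by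
  rcases Nat.eq_zero_or_pos m with rfl | hpos
  · exact Or.inl rfl
  · right
    obtain ⟨p, hp, hpm⟩ : ∃ p : ℕ, p.Prime ∧ p * p ∣ m := by
      by_contra hcon
      exact hm (Nat.squarefree_iff_prime_squarefree.2 fun p hp h => hcon ⟨p, hp, h⟩)
    exact ⟨p, hp.two_le, hpm, (Nat.le_of_dvd hpos (dvd_trans (Dvd.intro p rfl) hpm))⟩

/-- A square factor `x²` with `2 ≤ x` rules out squarefreeness. -/
theorem not_squarefree_of_sq_dvd {m x : ℕ} (hx : 2 ≤ x) (hxm : x * x ∣ m) : ¬ Squarefree m := by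
  intro hsq
  have h1 : x = 1 := Nat.isUnit_iff.1 (hsq x hxm)
  omega

/-! ### The verifier (a closed brick term, packaged with its value)

On `z = ⟨w, y⟩` it accepts iff `¬ (⌜decodeNat w⌝ = w ∧ w ≠ [] ∧ ¬ (2 ≤ ⟦y⟧ ∧ ⟦w⟧ mod ⟦y⟧² = 0))`,
i.e. iff `w` is not a numeral, or `w = ⌜0⌝`, or `⟦y⟧ ≥ 2` and `⟦y⟧² ∣ ⟦w⟧`. -/

/-- **The SQUAREFUL verifier**: a polynomial-time (`FP`, by brick closure), one-bit string function
with the displayed value on pairs — assembled from the numeral canonicaliser `canonF`, string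
equality `eqPairFn`, `isNilFn`, `valGeTwoFn`, `prodFn`, `remFn` under `andFn` / `notFn`. -/
theorem exists_squareful_verifier :
    ∃ V : List Bool → List Bool, V ∈ FP ∧ OneBit V ∧ ∀ w y : List Bool,
      V (boolPair w y) = [!(decide (encodeNat (decodeNat w) = w) && (!decide (w = []) &&
        !(decide (2 ≤ bitsToNat y) && decide (bitsToNat w % (bitsToNat y * bitsToNat y) = 0))))] := by
  refine ⟨notFn (andFn (eqPairFn ∘ fanoutFn (canonF ∘ fstF) fstF) (andFn (notFn (isNilFn ∘ fstF))
    (notFn (andFn (valGeTwoFn ∘ sndF) (isNilFn ∘ remFn ∘ fanoutFn fstF (prodFn ∘ fanoutFn sndF sndF)))))),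
    ?_, ?_, fun w y => ?_⟩
  · exact notFn_mem_FP (andFn_mem_FP
      (comp_mem_FP eqPairFn_mem_FP (fanoutFn_mem_FP (comp_mem_FP canonF_mem_FP fstF_mem_FP) fstF_mem_FP))
      (andFn_mem_FP (notFn_mem_FP (comp_mem_FP isNilFn_mem_FP fstF_mem_FP))
        (notFn_mem_FP (andFn_mem_FP (comp_mem_FP valGeTwoFn_mem_FP sndF_mem_FP)
          (comp_mem_FP isNilFn_mem_FP (comp_mem_FP remFn_mem_FP
            (fanoutFn_mem_FP fstF_mem_FP (comp_mem_FP prodFn_mem_FP (fanoutFn_mem_FP sndF_mem_FP sndF_mem_FP)))))))))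
  · exact oneBit_notFn (oneBit_andFn (oneBit_eqPairFn.comp _) (oneBit_andFn (oneBit_notFn (oneBit_isNilFn.comp _))
      (oneBit_notFn (oneBit_andFn (oneBit_valGeTwoFn.comp _) (oneBit_isNilFn.comp _)))))
  · -- values of the four pieces on the pair `⟨w, y⟩`
    have hc : (eqPairFn ∘ fanoutFn (canonF ∘ fstF) fstF) (boolPair w y) = [decide (encodeNat (decodeNat w) = w)] := by
      rw [Function.comp_apply, fanoutFn_apply, eqPairFn_boolPair, Function.comp_apply, fstF_boolPair,
        canonF_eq_encodeNat_decodeNat]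
    have hn : (isNilFn ∘ fstF) (boolPair w y) = [decide (w = [])] := by
      rw [Function.comp_apply, fstF_boolPair]; rfl
    have hg : (valGeTwoFn ∘ sndF) (boolPair w y) = [decide (2 ≤ bitsToNat y)] := by
      rw [Function.comp_apply, sndF_boolPair]; rfl
    have hd : (isNilFn ∘ remFn ∘ fanoutFn fstF (prodFn ∘ fanoutFn sndF sndF)) (boolPair w y) =
        [decide (bitsToNat w % (bitsToNat y * bitsToNat y) = 0)] := by
      rw [Function.comp_apply, Function.comp_apply, fanoutFn_apply, fstF_boolPair, Function.comp_apply,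
        fanoutFn_apply, sndF_boolPair, prodFn_boolPair, remFn_boolPair, bitsToNat_encodeNat]
      show [decide (encodeNat _ = [])] = _
      rw [Bool.decide_congr (encodeNat_eq_nil_iff _)]
    rw [notFn_apply (andFn_apply hc (andFn_apply (notFn_apply hn) (notFn_apply (andFn_apply hg hd))))]

/-! ### `SQUAREFUL ∈ NP`, `SQUAREFREES ∈ coNP` -/

/-- **The complement of `SQF = bin {m | Squarefree m}` is in `NP`.** Certificate of a non-numeral
or of `⌜0⌝`: the empty string; of `⌜m⌝`, `m > 0` not squarefree: `⌜p⌝` for a prime `p` with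
`p² ∣ m` (`|⌜p⌝| ≤ |⌜m⌝|`, witness polynomial `X`). [Arora–Barak 2009, Def. 2.1; Adleman–McCurley
1994, O8] -/
theorem squarefree_compl_mem_NP :
    (encodingNatBool.toLanguage {m : ℕ | Squarefree m})ᶜ ∈ Nondeterministic.NP := by
  obtain ⟨V, hV, h1, hVal⟩ := exists_squareful_verifier
  refine ⟨{z : List Bool | V z = [true]}, mem_P_of_mem_FP hV _ (fun z => ⟨id, fun hz => ?_⟩), X, fun w => ?_⟩
  · obtain ⟨b, hb⟩ := h1 z
    cases b
    · exact hb
    · exact absurd hb hz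
  show w ∈ (encodingNatBool.toLanguage {m : ℕ | Squarefree m})ᶜ ↔
    ∃ y, y.length ≤ X.eval w.length ∧ V (boolPair w y) = [true]
  have hmem : ∀ m : ℕ, encodeNat m ∈ encodingNatBool.toLanguage {m : ℕ | Squarefree m} ↔ Squarefree m :=
    fun m => encodingNatBool.mem_toLanguage_iff {m : ℕ | Squarefree m} m
  constructor
  · intro hw
    by_cases hc : encodeNat (decodeNat w) = w
    · -- `w = ⌜m⌝` with `m` not squarefree
      have hm : ¬ Squarefree (decodeNat w) := fun h => hw (hc ▸ (hmem _).2 h)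
      rcases exists_sq_dvd_of_not_squarefree hm with h0 | ⟨x, hx2, hxm, hxle⟩
      · refine ⟨[], by simp, ?_⟩
        have hw0 : w = [] := by rw [← hc, h0]; rfl
        rw [hVal]; simp [hw0]
      · refine ⟨encodeNat x, ?_, ?_⟩
        · rw [eval_X]
          calc (encodeNat x).length ≤ (encodeNat (decodeNat w)).length := length_encodeNat_mono hxle
            _ = w.length := by rw [hc]
        · have hval : bitsToNat w = decodeNat w := by
            conv_lhs => rw [← hc]
            exact bitsToNat_encodeNat _
          have hdv : bitsToNat w % (x * x) = 0 := by rw [hval]; exact Nat.mod_eq_zero_of_dvd hxm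
          rw [hVal]
          simp [hc, bitsToNat_encodeNat, hx2, hdv]
    · -- `w` is not a numeral
      refine ⟨[], by simp, ?_⟩
      rw [hVal]; simp [hc]
  · rintro ⟨y, -, hy⟩ hwL
    obtain ⟨m, hmS, hmw⟩ := hwL
    subst hmw
    have hsq : Squarefree m := hmS
    have hy' : V (boolPair (encodeNat m) y) = [true] := hy
    rw [hVal, decode_encodeNat, bitsToNat_encodeNat] at hy'
    by_cases h0 : encodeNat m = []
    · exact absurd (((encodeNat_eq_nil_iff m).1 h0) ▸ hsq) not_squarefree_zero
    · by_cases h2 : 2 ≤ bitsToNat y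
      · by_cases hd : m % (bitsToNat y * bitsToNat y) = 0
        · exact not_squarefree_of_sq_dvd h2 (Nat.dvd_of_mod_eq_zero hd) hsq
        · simp [h0, h2, hd] at hy'
      · simp [h0, h2] at hy'

/-- `SQF ∈ coNP`. -/
theorem squarefree_mem_coNP : encodingNatBool.toLanguage {m : ℕ | Squarefree m} ∈ coNP :=
  squarefree_compl_mem_NP

/-! ### Separation strength of the apex -/

/-- **The apex implies `NP ⊄ P/poly`** (closure of `P/poly` under complement). -/
theorem NP_not_subset_PPoly_of_squarefree_not_mem_PPoly
    (h : encodingNatBool.toLanguage {m : ℕ | Squarefree m} ∉ PPoly) :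
    ¬ Nondeterministic.NP ⊆ PPoly := by
  intro hsub
  have hc : (encodingNatBool.toLanguage {m : ℕ | Squarefree m})ᶜ ∈ PPoly := hsub squarefree_compl_mem_NP
  have := compl_mem_PPoly hc
  rw [compl_compl] at this
  exact h this

/-- **The apex implies `P ≠ NP`** (tree theorem `P ⊆ P/poly`). -/
theorem P_ne_NP_of_squarefree_not_mem_PPoly
    (h : encodingNatBool.toLanguage {m : ℕ | Squarefree m} ∉ PPoly) :
    (Classes.P : Set (Language Bool)) ≠ Nondeterministic.NP := fun hEq =>
  NP_not_subset_PPoly_of_squarefree_not_mem_PPoly h (fun _ hL => P_subset_PPoly_holds (hEq ▸ hL))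

/-- Contrapositive, as the refutation surface of the apex reads it: if `NP ⊆ P/poly` then the apex
fails (and the line `Sketch` says nothing about the crux). -/
theorem squarefree_mem_PPoly_of_NP_subset_PPoly (hsub : Nondeterministic.NP ⊆ PPoly) :
    encodingNatBool.toLanguage {m : ℕ | Squarefree m} ∈ PPoly := by
  by_contra h
  exact NP_not_subset_PPoly_of_squarefree_not_mem_PPoly h hsub

end Summit.QuantumAdvantage.QuantumAdvantage.Theorems.IqThreeNotPPoly

end
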